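import Summits.HodgeConjecture.CorCM.PairFlipSlotCoefficientCriterion
import HarnessLib

/-!
# THE KERNEL OF A COLLAPSE MAP THROUGH THE ORBITS OF A POINT STABILISER: one free constant per conjugation-odd orbit
# pair of `Stab(x₀)` on the partner slot, and the exact additivity criterion for an irreducible slot in ORBIT form

COR-CM (cell `pub-hodgecm2`, binder seat `b16` gen 53, count-neutral claim ORBIT-CRITERION, file F1 — abstract `G`-set
level; theorems only, no definition, no named fact, no `sorry`).  NEW as stated, hence under `Summits/`.  HONEST FRAMING:
finite-dimensional linear algebra about the Kubota–Dodson rank of families of CM types and its reading on products of CM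
abelian varieties; `HC_CM` is neither used nor asserted.

SETTING (tree notation of `Literature.NumberTheory.ComplexMultiplication.CMTypeRank*`, seat b16 gens 49–52
`ParallelShadowsSlots`, `RelativePairFlipKernel`, `PairFlipSlotCoefficientCriterion`).  A group `G` acts on a BASE slot `X`
and a PARTNER slot `Y`; `Φ₀ ⊆ X`, `Φ₁ ⊆ Y` are CM types for a central involution `ρ`; type vectors `u₀ = u_1(Φ₀)`,
`u₁ = u_1(Φ₁)` (`±1`); a base point `x₀ ∈ X`.  NO map `Y → X`, NO transitivity, NO flip hypothesis.  Gen 52's F8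
(`forall_map_le_iff_not_exists_coeff`) says: for `U(Φ₀)` irreducible the pair `(Φ₀, Φ₁)` is NOT additive iff some
coefficient vector `λ : Y → ℚ` has `Σ_y λ(y) u₁(g y) = u₀(g x₀)` for all `g`; gen 52's F1/F6 computed `λ` when `Y` fibres
over `X` with relative pair flips / pointwise partial conjugations off the two fibres of `x₀`.  This file is the general
ORBIT DECOMPOSITION announced in the TOWER-SHADOW card («one free constant per splitting orbit pair»):

Let `O_j ⊆ Y` (`j ∈ κ`, finitely many) be sets on each of which `Stab(x₀)` acts TRANSITIVELY
(`∀ y, y' ∈ O_j ∃ g, g x₀ = x₀ ∧ g y = y'`), pairwise SEPARATED together with their conjugates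
(`j ≠ j' ⟹ O_j ∩ O_{j'} = O_j ∩ ρO_{j'} = ∅`), and such that every point `y` OFF `⋃_j (O_j ∪ ρO_j)` carries a POINTWISE
PARTIAL CONJUGATION (`∃ σ, σ x₀ = ρ x₀ ∧ σ y = y`; for CM fields gen 48's compositum test
`y(K₁) ⊄ x₀(K₀)·y(K₁⁺)`).  Then:

* §1 **`antiVec_one_eq_sum_mul_orbitSum_of_collapse`** (the kernel computation).  Every `G`-equivariant `L : ℚ^Y → ℚ^X`
  with `L u₁ = u₀` yields constants `c_j` with `u₀(g x₀) = Σ_j c_j · Σ_{y ∈ O_j} u₁(g y)` for every `g ∈ G` — the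
  invariant kernel `S(y, x) = (Lδ_y)(x)` gives the functional `ℓ(y) = S(y, x₀) − S(y, ρx₀)`, `Stab(x₀)`-invariant (constant
  `c_j` on `O_j`), `ρ`-odd (`−c_j` on `ρO_j`; `c_j = 0` if `O_j` meets `ρO_j`) and ZERO off the orbits; pairing with the
  translates of `u₁` gives the identity.  The orbit sums `g ↦ Σ_{y∈O_j} u₁(g y) = 2·#{y ∈ O_j : g y ∈ Φ₁} − #O_j` are the
  ORBIT SHADOWS of `Φ₁` (for `O = r⁻¹x₀` a fibre: Yanai's multiplicities, gen 49/52).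
* §2 **`exists_coeff_of_orbitCoeff`**: conversely such constants give a coefficient vector `λ = Σ_j c_j 𝟙_{O_j}` (no
  hypothesis on the `O_j`), hence NON-additivity (`typeRank_sigmaType_add_card_lt_of_orbitCoeff`, via gen 52's F8).
* §3 **`forall_map_le_iff_not_exists_orbitCoeff`** — THE EXACT CRITERION IN ORBIT FORM: `I = {i₀, i₁}`, `U(Φ_{i₀})`
  irreducible (e.g. a pair-flip base), orbit data as above: the pair is ADDITIVE (`ext_i U(Φ_i) ≤ U(Σ)`,
  `Hg(A₀ × A₁) = Hg(A₀) × Hg(A₁)`) IFF `u₀(· x₀)` is NOT a rational combination of the orbit shadows of `Φ₁`; rank form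
  `typeRank_sigmaType_add_card_eq_iff_not_exists_orbitCoeff`, nondegeneracy form
  `typeRank_sigmaType_eq_iff_not_exists_orbitCoeff`.  The number of unknowns is the number of orbits listed, i.e. (when
  the `O_j` are the `Stab(x₀)`-orbits failing the conjugation test, one from each pair `{O, ρO}`) the number of
  conjugation-odd orbit pairs = `dim Hom_G(Anti X, Anti Y)` (gen 48's count) — versus `|Y|` unknowns in F8.
Sequel `StabiliserOrbitCriterion`: ONE orbit (constant unequal orbit multiplicities — fibres of gen 52 and reflex
incidence of gen 45 at once), ZERO orbits (gen 48's pointwise criterion recovered), pair-flip bases.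

## References

* [Serre1977] J.-P. Serre, *Linear Representations of Finite Groups*, GTM 42, §7.2–7.4 (Frobenius reciprocity, Mackey:
  intertwiners of permutation modules ↔ orbits of a point stabiliser / double cosets).
* [Gordon1999HodgeAVSurvey] B. B. Gordon, *A survey of the Hodge conjecture for abelian varieties*, §3 Theorem (Imai,
  Murty) with proof (the character computation), 7.5–7.7, 9.4.3.
* [Dodson1984] B. Dodson, *The structure of Galois groups of CM-fields*, Trans. AMS 283 (1984), §1.1, §5.1.2.
-/

set_option autoImplicit false

noncomputable section

open scoped BigOperators

universe u v w

namespace Summit.HodgeConjecture.CorCM.Shadow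

open Literature.NumberTheory.ComplexMultiplication
open scoped Classical

variable {G : Type u} [Group G]

/-! ### §1 The kernel of a collapse map through stabiliser orbits -/

section Kernel

variable {X Y : Type*} [MulAction G X] [MulAction G Y] [Fintype X] [Fintype Y]

omit [Fintype X] in
/-- Reindexing along the involution: `Σ_y [ρ y ∈ O] f(y) = Σ_{y ∈ O} f(ρ y)`. [folklore] -/
theorem sum_ite_rho_smul_mem {ρ : G} (hρ : ∀ y : Y, ρ • ρ • y = y) (O : Set Y) (f : Y → ℚ) :
    ∑ y, (if ρ • y ∈ O then f y else 0) = ∑ y ∈ Finset.univ.filter (fun y : Y => y ∈ O), f (ρ • y) := by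
  rw [Finset.sum_filter]
  refine Fintype.sum_equiv (MulAction.toPerm ρ) _ _ fun y => ?_
  simp only [MulAction.toPerm_apply, hρ]

omit [Fintype X] in
/-- **Orbit shadows are odd along the partner's conjugation**: `Σ_{y ∈ O} u_1(Φ₁)(g ρ y) = − Σ_{y ∈ O} u_1(Φ₁)(g y)`.
[folklore] -/
theorem orbitSum_antiVec_one_smul_rho {ρ : G} {Φ₁ : Set Y} (h₁ : IsCMTypeWith ρ Φ₁) (O : Set Y) (g : G) :
    ∑ y ∈ Finset.univ.filter (fun y : Y => y ∈ O), antiVec Φ₁ (1 : G) (g • ρ • y) =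
      -∑ y ∈ Finset.univ.filter (fun y : Y => y ∈ O), antiVec Φ₁ (1 : G) (g • y) := by
  rw [← Finset.sum_neg_distrib]
  refine Finset.sum_congr rfl fun y _ => ?_
  rw [h₁.comm g y]
  exact (mem_antiWeights_iff'.1 (antiVec_mem_antiWeights h₁ 1)) (g • y)

omit [Fintype X] in
/-- **The orbit shadow counts points**: `Σ_{y ∈ O} u_1(Φ₁)(g y) = 2·#{y ∈ O : g y ∈ Φ₁} − #O`. [folklore] -/
theorem orbitSum_antiVec_one_eq (Φ₁ : Set Y) (O : Set Y) (g : G) :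
    ∑ y ∈ Finset.univ.filter (fun y : Y => y ∈ O), antiVec Φ₁ (1 : G) (g • y) =
      2 * ((Finset.univ.filter fun y : Y => y ∈ O ∧ g • y ∈ Φ₁).card : ℚ) -
        ((Finset.univ.filter fun y : Y => y ∈ O).card : ℚ) := by
  have h1 : ∀ y : Y, antiVec Φ₁ (1 : G) (g • y) = 2 * (if g • y ∈ Φ₁ then (1 : ℚ) else 0) - 1 := by
    intro y
    rw [antiVec_one_eq_ite]
    split_ifs <;> norm_num
  simp_rw [h1]
  rw [Finset.sum_sub_distrib, Finset.sum_const, nsmul_eq_mul, mul_one, ← Finset.mul_sum, ← Finset.sum_filter,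
    Finset.filter_filter, Finset.sum_const, nsmul_eq_mul, mul_one]

omit [Fintype X] in
/-- **THE KERNEL COMPUTATION THROUGH STABILISER ORBITS.**  `Φ₀ ⊆ X`, `Φ₁ ⊆ Y` CM types for `ρ`, `x₀ ∈ X`; sets `O_j ⊆ Y`
on which `Stab(x₀)` is transitive, separated from each other and from each other's conjugates, every point off
`⋃_j (O_j ∪ ρO_j)` carrying a pointwise partial conjugation `σ x₀ = ρ x₀`, `σ y = y`.  Then every `G`-equivariant
`L : ℚ^Y → ℚ^X` with `L u_1(Φ₁) = u_1(Φ₀)` gives constants `c_j` with `u_1(Φ₀)(g x₀) = Σ_j c_j Σ_{y ∈ O_j} u_1(Φ₁)(g y)` for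
all `g ∈ G` (functional `ℓ(y) = (Lδ_y)(x₀) − (Lδ_y)(ρx₀)`: constant on each `O_j`, opposite on `ρO_j`, zero elsewhere).
No transitivity, map or flip hypothesis. [cite: Serre1977, §7.2–7.4] [cite: Gordon1999HodgeAVSurvey, §3 Theorem (proof)] -/
theorem antiVec_one_eq_sum_mul_orbitSum_of_collapse {ρ : G} {Φ₀ : Set X} {Φ₁ : Set Y} (h₀ : IsCMTypeWith ρ Φ₀)
    (h₁ : IsCMTypeWith ρ Φ₁) {x₀ : X} {κ : Type w} [Fintype κ] (O : κ → Set Y)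
    (hO : ∀ j, ∀ y ∈ O j, ∀ y' ∈ O j, ∃ g : G, g • x₀ = x₀ ∧ g • y = y')
    (hdisj : ∀ j j', j ≠ j' → ∀ y ∈ O j, y ∉ O j' ∧ ρ • y ∉ O j')
    (hoff : ∀ y : Y, (∀ j, y ∉ O j ∧ ρ • y ∉ O j) → ∃ σ : G, σ • x₀ = ρ • x₀ ∧ σ • y = y)
    (L : (Y → ℚ) →ₗ[ℚ] (X → ℚ)) (hL : ∀ (g : G) (f : Y → ℚ), L (fun y => f (g • y)) = fun x => L f (g • x))
    (hLu : L (antiVec Φ₁ (1 : G)) = antiVec Φ₀ (1 : G)) :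
    ∃ c : κ → ℚ, ∀ g : G, antiVec Φ₀ (1 : G) (g • x₀) =
      ∑ j, c j * ∑ y ∈ Finset.univ.filter (fun y : Y => y ∈ O j), antiVec Φ₁ (1 : G) (g • y) := by
  -- the invariant kernel `S y x = (L δ_y)(x)`
  set S : Y → X → ℚ := fun y x => L (Pi.single y 1) x with hSdef
  have hSinv : ∀ (g : G) (y : Y) (x : X), S (g • y) (g • x) = S y x := by
    intro g y x
    have h1 : (fun y' => (Pi.single (g • y) (1 : ℚ) : Y → ℚ) (g • y')) = Pi.single y 1 := by
      funext y'
      by_cases hy : y' = y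
      · rw [hy, Pi.single_eq_same, Pi.single_eq_same]
      · rw [Pi.single_eq_of_ne hy, Pi.single_eq_of_ne (fun h => hy (smul_left_cancel g h))]
    have h2 := hL g (Pi.single (g • y) 1)
    rw [h1] at h2
    exact (congrFun h2 x).symm
  -- expansion of `(L f)(x)` along the kernel
  have hexp : ∀ (f : Y → ℚ) (x : X), L f x = ∑ y, f y * S y x := by
    intro f x
    have hf : f = ∑ y, f y • (Pi.single y (1 : ℚ) : Y → ℚ) := by
      funext y'
      rw [Finset.sum_apply]
      simp only [Pi.smul_apply, Pi.single_apply, smul_eq_mul, mul_ite, mul_one, mul_zero]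
      rw [Finset.sum_ite_eq Finset.univ y' f, if_pos (Finset.mem_univ _)]
    conv_lhs => rw [hf]
    rw [map_sum, Finset.sum_apply]
    refine Finset.sum_congr rfl fun y _ => ?_
    rw [map_smul, Pi.smul_apply, smul_eq_mul]
  -- the functional `ℓ(y) = S y x₀ − S y (ρ x₀)`
  set ℓ : Y → ℚ := fun y => S y x₀ - S y (ρ • x₀) with hℓdef
  have hconst : ∀ j, ∀ y ∈ O j, ∀ y' ∈ O j, ℓ y = ℓ y' := by
    intro j y hy y' hy'
    obtain ⟨g, hgx, hgy⟩ := hO j y hy y' hy'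
    show S y x₀ - S y (ρ • x₀) = S y' x₀ - S y' (ρ • x₀)
    rw [← hSinv g y x₀, ← hSinv g y (ρ • x₀), hgy, h₀.comm g x₀, hgx]
  have hzero : ∀ y : Y, (∀ j, y ∉ O j ∧ ρ • y ∉ O j) → ℓ y = 0 := by
    intro y hy
    obtain ⟨σ, hσx, hσy⟩ := hoff y hy
    show S y x₀ - S y (ρ • x₀) = 0
    have h1 : S y x₀ = S y (ρ • x₀) := by rw [← hSinv σ y x₀, hσy, hσx]
    rw [h1, sub_self]
  have hopp : ∀ y : Y, ℓ y = -ℓ (ρ • y) := by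
    intro y
    show S y x₀ - S y (ρ • x₀) = -(S (ρ • y) x₀ - S (ρ • y) (ρ • x₀))
    rw [← hSinv ρ y x₀, ← hSinv ρ y (ρ • x₀), h₀.invol]
    ring
  -- one constant per orbit
  obtain ⟨c, hc⟩ : ∃ c : κ → ℚ, ∀ j, ∀ y ∈ O j, ℓ y = c j := by
    refine ⟨fun j => if hj : ∃ y, y ∈ O j then ℓ (Classical.choose hj) else 0, fun j y hy => ?_⟩
    have hj : ∃ y, y ∈ O j := ⟨y, hy⟩
    show ℓ y = if hj : ∃ y, y ∈ O j then ℓ (Classical.choose hj) else 0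
    rw [dif_pos hj]
    exact hconst j y hy _ (Classical.choose_spec hj)
  have hc0 : ∀ (j : κ) (y : Y), y ∈ O j → ρ • y ∈ O j → c j = 0 := by
    intro j y hy hρy
    have h1 := hc j y hy
    have h2 := hc j (ρ • y) hρy
    have h3 := hopp y
    linarith
  -- closed formula for `ℓ`
  have hℓval : ∀ y : Y, ℓ y =
      ∑ j, c j * ((if y ∈ O j then (1 : ℚ) else 0) - (if ρ • y ∈ O j then (1 : ℚ) else 0)) := by
    intro y
    by_cases hin : ∃ j, y ∈ O j
    · obtain ⟨j₀, hj₀⟩ := hin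
      rw [Finset.sum_eq_single j₀ ?_ (fun h => absurd (Finset.mem_univ j₀) h)]
      · rw [if_pos hj₀]
        by_cases hρ : ρ • y ∈ O j₀
        · rw [if_pos hρ, hc j₀ y hj₀, hc0 j₀ y hj₀ hρ]; ring
        · rw [if_neg hρ, hc j₀ y hj₀]; ring
      · intro j _ hj
        obtain ⟨h1, h2⟩ := hdisj j₀ j (Ne.symm hj) y hj₀
        rw [if_neg h1, if_neg h2]; ring
    · push Not at hin
      by_cases hin' : ∃ j, ρ • y ∈ O j
      · obtain ⟨j₀, hj₀⟩ := hin'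
        rw [Finset.sum_eq_single j₀ ?_ (fun h => absurd (Finset.mem_univ j₀) h)]
        · rw [if_neg (hin j₀), if_pos hj₀, hopp y, hc j₀ (ρ • y) hj₀]; ring
        · intro j _ hj
          obtain ⟨h2, -⟩ := hdisj j₀ j (Ne.symm hj) (ρ • y) hj₀
          rw [if_neg (hin j), if_neg h2]; ring
      · push Not at hin'
        rw [hzero y (fun j => ⟨hin j, hin' j⟩)]
        symm
        refine Finset.sum_eq_zero fun j _ => ?_
        rw [if_neg (hin j), if_neg (hin' j)]; ring
  -- pair `ℓ` with the translates of `u_1(Φ₁)`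
  have hodd₀ : ∀ x : X, antiVec Φ₀ (1 : G) (ρ • x) = -antiVec Φ₀ (1 : G) x := fun x =>
    (mem_antiWeights_iff'.1 (antiVec_mem_antiWeights h₀ 1)) x
  refine ⟨c, fun g => ?_⟩
  have hLg : L (fun y => antiVec Φ₁ (1 : G) (g • y)) = fun x => antiVec Φ₀ (1 : G) (g • x) := by
    rw [hL g, hLu]
  have lhs : L (fun y => antiVec Φ₁ (1 : G) (g • y)) x₀ - L (fun y => antiVec Φ₁ (1 : G) (g • y)) (ρ • x₀) =
      2 * antiVec Φ₀ (1 : G) (g • x₀) := by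
    rw [hLg]
    show antiVec Φ₀ (1 : G) (g • x₀) - antiVec Φ₀ (1 : G) (g • ρ • x₀) = _
    rw [h₀.comm g x₀, hodd₀]
    ring
  have rhs : L (fun y => antiVec Φ₁ (1 : G) (g • y)) x₀ - L (fun y => antiVec Φ₁ (1 : G) (g • y)) (ρ • x₀) =
      ∑ y, antiVec Φ₁ (1 : G) (g • y) * ℓ y := by
    rw [hexp _ x₀, hexp _ (ρ • x₀), ← Finset.sum_sub_distrib]
    refine Finset.sum_congr rfl fun y _ => ?_
    show _ = antiVec Φ₁ (1 : G) (g • y) * (S y x₀ - S y (ρ • x₀))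
    ring
  -- evaluation of `Σ_y u₁(g y) ℓ(y)` orbit by orbit
  have horb : ∀ j : κ, ∑ y, antiVec Φ₁ (1 : G) (g • y) *
      (c j * ((if y ∈ O j then (1 : ℚ) else 0) - (if ρ • y ∈ O j then (1 : ℚ) else 0))) =
        2 * (c j * ∑ y ∈ Finset.univ.filter (fun y : Y => y ∈ O j), antiVec Φ₁ (1 : G) (g • y)) := by
    intro j
    have e1 : ∑ y, antiVec Φ₁ (1 : G) (g • y) * (if y ∈ O j then (1 : ℚ) else 0) =
        ∑ y ∈ Finset.univ.filter (fun y : Y => y ∈ O j), antiVec Φ₁ (1 : G) (g • y) := by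
      rw [Finset.sum_filter]
      refine Finset.sum_congr rfl fun y _ => ?_
      split_ifs <;> simp
    have e2 : ∑ y, antiVec Φ₁ (1 : G) (g • y) * (if ρ • y ∈ O j then (1 : ℚ) else 0) =
        -∑ y ∈ Finset.univ.filter (fun y : Y => y ∈ O j), antiVec Φ₁ (1 : G) (g • y) := by
      have e3 : ∑ y, antiVec Φ₁ (1 : G) (g • y) * (if ρ • y ∈ O j then (1 : ℚ) else 0) =
          ∑ y, (if ρ • y ∈ O j then antiVec Φ₁ (1 : G) (g • y) else 0) := by
        refine Finset.sum_congr rfl fun y _ => ?_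
        split_ifs <;> simp
      rw [e3, sum_ite_rho_smul_mem h₁.invol (O j), orbitSum_antiVec_one_smul_rho h₁ (O j) g]
    calc ∑ y, antiVec Φ₁ (1 : G) (g • y) *
          (c j * ((if y ∈ O j then (1 : ℚ) else 0) - (if ρ • y ∈ O j then (1 : ℚ) else 0)))
          = c j * (∑ y, antiVec Φ₁ (1 : G) (g • y) * (if y ∈ O j then (1 : ℚ) else 0) -
              ∑ y, antiVec Φ₁ (1 : G) (g • y) * (if ρ • y ∈ O j then (1 : ℚ) else 0)) := by
            rw [← Finset.sum_sub_distrib, Finset.mul_sum]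
            refine Finset.sum_congr rfl fun y _ => ?_
            ring
      _ = 2 * (c j * ∑ y ∈ Finset.univ.filter (fun y : Y => y ∈ O j), antiVec Φ₁ (1 : G) (g • y)) := by
            rw [e1, e2]
            ring
  have htot : ∑ y, antiVec Φ₁ (1 : G) (g • y) * ℓ y =
      2 * ∑ j, c j * ∑ y ∈ Finset.univ.filter (fun y : Y => y ∈ O j), antiVec Φ₁ (1 : G) (g • y) := by
    calc ∑ y, antiVec Φ₁ (1 : G) (g • y) * ℓ y
        = ∑ y, ∑ j, antiVec Φ₁ (1 : G) (g • y) *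
            (c j * ((if y ∈ O j then (1 : ℚ) else 0) - (if ρ • y ∈ O j then (1 : ℚ) else 0))) := by
          refine Finset.sum_congr rfl fun y _ => ?_
          rw [hℓval y, Finset.mul_sum]
      _ = ∑ j, ∑ y, antiVec Φ₁ (1 : G) (g • y) *
            (c j * ((if y ∈ O j then (1 : ℚ) else 0) - (if ρ • y ∈ O j then (1 : ℚ) else 0))) :=
          Finset.sum_comm
      _ = ∑ j, 2 * (c j * ∑ y ∈ Finset.univ.filter (fun y : Y => y ∈ O j), antiVec Φ₁ (1 : G) (g • y)) :=
          Finset.sum_congr rfl fun j _ => horb j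
      _ = 2 * ∑ j, c j * ∑ y ∈ Finset.univ.filter (fun y : Y => y ∈ O j), antiVec Φ₁ (1 : G) (g • y) := by
          rw [← Finset.mul_sum]
  have key := lhs.symm.trans (rhs.trans htot)
  linarith

end Kernel

/-! ### §2 Orbit constants are coefficient vectors -/

section Coeff

variable {X Y : Type*} [MulAction G X] [MulAction G Y] [Fintype Y]

/-- **Orbit constants give a coefficient vector** `λ = Σ_j c_j 𝟙_{O_j}`:
`Σ_y λ(y) u_1(Φ₁)(g y) = Σ_j c_j Σ_{y ∈ O_j} u_1(Φ₁)(g y) = u_1(Φ₀)(g x₀)`.  No hypothesis on the sets `O_j`.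
[cite: Gordon1999HodgeAVSurvey, §3 Theorem (proof)] -/
theorem exists_coeff_of_orbitCoeff {Φ₀ : Set X} {Φ₁ : Set Y} {x₀ : X} {κ : Type w} [Fintype κ] (O : κ → Set Y)
    {c : κ → ℚ} (hc : ∀ g : G, antiVec Φ₀ (1 : G) (g • x₀) =
      ∑ j, c j * ∑ y ∈ Finset.univ.filter (fun y : Y => y ∈ O j), antiVec Φ₁ (1 : G) (g • y)) :
    ∃ lam : Y → ℚ, ∀ g : G, ∑ y, lam y * antiVec Φ₁ (1 : G) (g • y) = antiVec Φ₀ (1 : G) (g • x₀) := by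
  refine ⟨fun y => ∑ j, c j * (if y ∈ O j then (1 : ℚ) else 0), fun g => ?_⟩
  rw [hc g]
  calc ∑ y, (∑ j, c j * (if y ∈ O j then (1 : ℚ) else 0)) * antiVec Φ₁ (1 : G) (g • y)
      = ∑ y, ∑ j, c j * (if y ∈ O j then (1 : ℚ) else 0) * antiVec Φ₁ (1 : G) (g • y) := by
        refine Finset.sum_congr rfl fun y _ => ?_
        rw [Finset.sum_mul]
    _ = ∑ j, ∑ y, c j * (if y ∈ O j then (1 : ℚ) else 0) * antiVec Φ₁ (1 : G) (g • y) := Finset.sum_comm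
    _ = ∑ j, c j * ∑ y ∈ Finset.univ.filter (fun y : Y => y ∈ O j), antiVec Φ₁ (1 : G) (g • y) := by
        refine Finset.sum_congr rfl fun j _ => ?_
        rw [Finset.sum_filter, Finset.mul_sum]
        refine Finset.sum_congr rfl fun y _ => ?_
        split_ifs <;> ring

end Coeff

/-! ### §3 Families: the exact criterion in orbit form -/

section Family

variable {I : Type v} {E : I → Type v} [∀ i, MulAction G (E i)] [DecidableEq I] [Fintype I] [∀ i, Fintype (E i)]
  {ρ : G} {Φ : ∀ i, Set (E i)} {i₀ i₁ : I} [Nonempty I] [∀ i, Nonempty (E i)]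

omit [DecidableEq I] in
/-- **Orbit constants make the rank non-additive**: `rank(Σ) + |I| < Σ_i rank(Φ_i) + 1` (no hypothesis on the sets `O_j`
beyond `i₀ ≠ i₁`). [cite: Gordon1999HodgeAVSurvey, §3 Theorem (proof) and 7.5] -/
theorem typeRank_sigmaType_add_card_lt_of_orbitCoeff (h : ∀ i, IsCMTypeWith ρ (Φ i)) (h01 : i₀ ≠ i₁) {x₀ : E i₀}
    {κ : Type w} [Fintype κ] (O : κ → Set (E i₁)) {c : κ → ℚ}
    (hc : ∀ g : G, antiVec (Φ i₀) (1 : G) (g • x₀) =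
      ∑ j, c j * ∑ y ∈ Finset.univ.filter (fun y : E i₁ => y ∈ O j), antiVec (Φ i₁) (1 : G) (g • y)) :
    typeRank G (sigmaType Φ) + Fintype.card I < (∑ i, typeRank G (Φ i)) + 1 := by
  obtain ⟨lam, hlam⟩ := exists_coeff_of_orbitCoeff (G := G) O hc
  exact typeRank_sigmaType_add_card_lt_of_coeff h h01 hlam

/-- **THE EXACT ADDITIVITY CRITERION IN ORBIT FORM.**  `I = {i₀, i₁}`, `U(Φ_{i₀})` irreducible, `x₀ ∈ E_{i₀}`; finitely
many sets `O_j ⊆ E_{i₁}`, each homogeneous under `Stab(x₀)`, separated from each other and from each other's conjugates,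
every point off `⋃_j (O_j ∪ ρO_j)` with a pointwise partial conjugation.  Then both slot extensions lie in `U(Σ)`
(`Hg(A₀ × A₁) = Hg(A₀) × Hg(A₁)`) IFF there are NO constants `c_j` with
`u_1(Φ_{i₀})(g x₀) = Σ_j c_j Σ_{y ∈ O_j} u_1(Φ_{i₁})(g y)` for all `g ∈ G`.
[cite: Serre1977, §2.2 and §7.2–7.4] [cite: Gordon1999HodgeAVSurvey, §3 Theorem and 7.5–7.7] -/
theorem forall_map_le_iff_not_exists_orbitCoeff (h : ∀ i, IsCMTypeWith ρ (Φ i)) (hI : ∀ j, j = i₀ ∨ j = i₁)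
    (h01 : i₀ ≠ i₁)
    (hirr : ∀ W : Submodule ℚ (E i₀ → ℚ), W ≤ antiSpan G (Φ i₀) → W ≠ ⊥ →
      (∀ (k : G) (f : E i₀ → ℚ), f ∈ W → (fun y => f (k • y)) ∈ W) → W = antiSpan G (Φ i₀))
    {x₀ : E i₀} {κ : Type w} [Fintype κ] (O : κ → Set (E i₁))
    (hO : ∀ j, ∀ y ∈ O j, ∀ y' ∈ O j, ∃ g : G, g • x₀ = x₀ ∧ g • y = y')
    (hdisj : ∀ j j', j ≠ j' → ∀ y ∈ O j, y ∉ O j' ∧ ρ • y ∉ O j')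
    (hoff : ∀ y : E i₁, (∀ j, y ∉ O j ∧ ρ • y ∉ O j) → ∃ σ : G, σ • x₀ = ρ • x₀ ∧ σ • y = y) :
    (∀ i, (antiSpan G (Φ i)).map (slotExt i) ≤ antiSpan G (sigmaType Φ)) ↔
      ¬ ∃ c : κ → ℚ, ∀ g : G, antiVec (Φ i₀) (1 : G) (g • x₀) =
        ∑ j, c j * ∑ y ∈ Finset.univ.filter (fun y : E i₁ => y ∈ O j), antiVec (Φ i₁) (1 : G) (g • y) := by
  constructor
  · rintro hadd ⟨c, hc⟩
    have h1 := typeRank_sigmaType_add_card_eq_of_forall_map_le h hadd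
    have h2 := typeRank_sigmaType_add_card_lt_of_orbitCoeff h h01 O hc
    omega
  · intro hnot
    rcases PairFlipTransport.additive_or_exists_collapse_of_irreducible hI h01 hirr with hadd | ⟨L, hL, -, hLu⟩
    · exact hadd
    · exact absurd (antiVec_one_eq_sum_mul_orbitSum_of_collapse (h i₀) (h i₁) O hO hdisj hoff L hL hLu) hnot

/-- **Rank form**: `rank(Σ) + |I| = Σ_i rank(Φ_i) + 1` IFF no orbit constants exist.
[cite: Gordon1999HodgeAVSurvey, §3 Theorem (1) and 7.5–7.7] -/
theorem typeRank_sigmaType_add_card_eq_iff_not_exists_orbitCoeff (h : ∀ i, IsCMTypeWith ρ (Φ i))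
    (hI : ∀ j, j = i₀ ∨ j = i₁) (h01 : i₀ ≠ i₁)
    (hirr : ∀ W : Submodule ℚ (E i₀ → ℚ), W ≤ antiSpan G (Φ i₀) → W ≠ ⊥ →
      (∀ (k : G) (f : E i₀ → ℚ), f ∈ W → (fun y => f (k • y)) ∈ W) → W = antiSpan G (Φ i₀))
    {x₀ : E i₀} {κ : Type w} [Fintype κ] (O : κ → Set (E i₁))
    (hO : ∀ j, ∀ y ∈ O j, ∀ y' ∈ O j, ∃ g : G, g • x₀ = x₀ ∧ g • y = y')
    (hdisj : ∀ j j', j ≠ j' → ∀ y ∈ O j, y ∉ O j' ∧ ρ • y ∉ O j')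
    (hoff : ∀ y : E i₁, (∀ j, y ∉ O j ∧ ρ • y ∉ O j) → ∃ σ : G, σ • x₀ = ρ • x₀ ∧ σ • y = y) :
    typeRank G (sigmaType Φ) + Fintype.card I = (∑ i, typeRank G (Φ i)) + 1 ↔
      ¬ ∃ c : κ → ℚ, ∀ g : G, antiVec (Φ i₀) (1 : G) (g • x₀) =
        ∑ j, c j * ∑ y ∈ Finset.univ.filter (fun y : E i₁ => y ∈ O j), antiVec (Φ i₁) (1 : G) (g • y) := by
  constructor
  · rintro heq ⟨c, hc⟩
    have h2 := typeRank_sigmaType_add_card_lt_of_orbitCoeff h h01 O hc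
    omega
  · intro hnot
    exact typeRank_sigmaType_add_card_eq_of_forall_map_le h
      ((forall_map_le_iff_not_exists_orbitCoeff h hI h01 hirr O hO hdisj hoff).2 hnot)

/-- **Nondegeneracy form**: with `Φ_{i₀}` nondegenerate, `Σ` is nondegenerate IFF `Φ_{i₁}` is nondegenerate and no orbit
constants exist. [cite: Gordon1999HodgeAVSurvey, 7.5–7.7] -/
theorem typeRank_sigmaType_eq_iff_not_exists_orbitCoeff (h : ∀ i, IsCMTypeWith ρ (Φ i)) (hI : ∀ j, j = i₀ ∨ j = i₁)
    (h01 : i₀ ≠ i₁)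
    (hirr : ∀ W : Submodule ℚ (E i₀ → ℚ), W ≤ antiSpan G (Φ i₀) → W ≠ ⊥ →
      (∀ (k : G) (f : E i₀ → ℚ), f ∈ W → (fun y => f (k • y)) ∈ W) → W = antiSpan G (Φ i₀))
    (hnd₀ : typeRank G (Φ i₀) = Fintype.card (E i₀) / 2 + 1)
    {x₀ : E i₀} {κ : Type w} [Fintype κ] (O : κ → Set (E i₁))
    (hO : ∀ j, ∀ y ∈ O j, ∀ y' ∈ O j, ∃ g : G, g • x₀ = x₀ ∧ g • y = y')
    (hdisj : ∀ j j', j ≠ j' → ∀ y ∈ O j, y ∉ O j' ∧ ρ • y ∉ O j')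
    (hoff : ∀ y : E i₁, (∀ j, y ∉ O j ∧ ρ • y ∉ O j) → ∃ σ : G, σ • x₀ = ρ • x₀ ∧ σ • y = y) :
    typeRank G (sigmaType Φ) = Fintype.card (Σ i, E i) / 2 + 1 ↔
      typeRank G (Φ i₁) = Fintype.card (E i₁) / 2 + 1 ∧
        ¬ ∃ c : κ → ℚ, ∀ g : G, antiVec (Φ i₀) (1 : G) (g • x₀) =
          ∑ j, c j * ∑ y ∈ Finset.univ.filter (fun y : E i₁ => y ∈ O j), antiVec (Φ i₁) (1 : G) (g • y) := by
  constructor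
  · intro hnd
    refine ⟨typeRank_eq_of_typeRank_sigmaType_eq h hnd i₁, fun ⟨c, hc⟩ => ?_⟩
    have h1 := typeRank_sigmaType_add_card_eq_of_forall_map_le h
      (forall_map_slotExt_le_of_typeRank_sigmaType_eq h hnd)
    have h2 := typeRank_sigmaType_add_card_lt_of_orbitCoeff h h01 O hc
    omega
  · rintro ⟨hnd₁, hnot⟩
    rw [typeRank_sigmaType_eq_iff_forall_of_forall_map_le h
      ((forall_map_le_iff_not_exists_orbitCoeff h hI h01 hirr O hO hdisj hoff).2 hnot)]
    intro i
    rcases hI i with rfl | rfl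
    · exact hnd₀
    · exact hnd₁

end Family

end Summit.HodgeConjecture.CorCM.Shadow

end
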